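import Summits.QuantumFields.YangMills.Theses.SqueezedSkewness
import Summits.QuantumFields.YangMills.Theorems.SqueezedSkewnessAntipodalReflectedDictionary
import Summits.QuantumFields.YangMills.Theorems.BalabanLadderNTMarkovMirrorReflect
import Summits.QuantumFields.YangMills.Theorems.LangevinControlUVOSLegsAtWeakCouplingCFblOfFbl6
import Summits.QuantumFields.YangMills.Theorems.LangevinControlUVOSLegsFromFemtoAndGapStubLowerCube
import Literature.MathematicalPhysics.QuantumLattice.LatticeGaugeDLRCovarianceSplit
import HarnessLib

/-!
# Route `SqueezedSkewness`, crux `AntipodalMirrorCeiling` (stmt-QuantumFields-23202), LINE «Markov ceiling» (planner ym-idea-6 g11,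
# idea-crit-9 VERDICT #53 PASS-WITH-PRICE, skeleton `Cruxes/NT/Lines/antipodal_markov_birth.lean` v2 @9a38efe2):
# the REGISTERED STUB `stub_markovGlueNarrow` — `FloorUnitFBL6 → BoundaryResponseMixing → AntipodalMirrorCeiling` — BY NAME AND SIGNATURE

The glue for the critic's NARROW twin (P2): the femto boundary law at floor-calibrated units (`FloorUnitFBL6`, fed `AntipodalMirrorCeiling`'s
own low-pass floor through `Or.inl`) and boundary-response mixing (`stub_boundaryResponseMixing`, the one family of observables the glue
consumes) give the antipodal mirror ceiling `N β (2L+1) (2L+1) ⌊(2L+1)/4⌋ ≤ η·a(β)⁸`.  Mechanism (every engine in the tree):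

* §1 `sum_ind_mul`, `zOf_axis`: the route's weight `ind h` picks the single site `x_h = (0⃗, h)`, `h = ⌊(2L+1)/4⌋`, whose time-first `ℤ⁴`
  image is `z₀ = zOf x_h = (h, 0⃗)`;
* ★ `cov_ind_reflFT_le` (THE CORE ESTIMATE, `FBL`-form input): with `FBL = (C₁, β₁, ℓ₁, p)`, `R := ⌊ℓ₁/(4a)⌋`, the centred odd cube
  `Q = (z₀ − R·1, 2R+1)` (`b·a ≤ ℓ₁`; `StubLower.le_depth_cube`: depth of the centre `≥ R+1 ≥ ℓ₁/(8a)`; window and straddling arithmetic from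
  the one natural-number fact `8R + 24 ≤ L`, itself from `a(β)·L ≥ 2ℓ₁ + 24`, `a(β) ≤ min(ℓ₁/8, 1)`):
  `N` = (reflected dictionary `SqueezedSkewnessAntipodalReflectedDictionary.covF_reflFT_eq_torusCov_reflect`) `Cov_T(dens z₀ ∘ Θ₀, dens z₀)`
  = (Markov mirror X2 `MarkovMirror.torusCov_reflect_lift_eq_torusCov_reflect_kerE`; `continuous_dens`, `abs_curvature_le`, `isCylinder_dens` +
  `near_of_mem_supp_dens` for the window) `Cov_T(kerE_Q(dens z₀) ∘ Θ₀, kerE_Q(dens z₀))` ≤ (mixing, with `m = p β`, the `FBL` sup bound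
  `s = C₁/(R+1)⁴` and tolerance `τ = η ℓ₁⁸/(8⁸(C₁²+1))`) `τ s²` ≤ `η·a⁸·C₁²/(C₁²+1) ≤ η·a⁸`;
* §3 the name-keyed statements of the skeleton VERBATIM (own namespace, as `…SqueezedSkewnessTorusKLStub`), `stub_markovGlueNarrow` from
  `fbl_of_fbl6` + the core estimate (the route's `let`-bound statement read by `dsimp only` + definitional unfolding of `eF`/`aF`/`reflFT`),
  and the compositions `antipodalMirrorCeiling_of_narrow` / `antipodalMirrorCeiling_of_via_twin` (conditional, as in the skeleton).

Width seat ym-line-sfw-p2-w5 g11 (cell ym-idea-1; free hands), `--supports stmt-QuantumFields-23202`.  THEOREMS ONLY.  HONEST FRAMING: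
`FloorUnitFBL6` (23389, XL), `AntipodalMixing` (23390) and the twin `stub_boundaryResponseMixing` stay OPEN, so the crux, the route's NT
statement and R2a (a RECORD rung) are NOT proved; the Yang–Mills mass gap is NOT proved by any of this.
-/

set_option autoImplicit false

noncomputable section



namespace Summit.QuantumFields.YangMills.Theorems.SqueezedSkewnessAntipodalMarkovGlueNarrow

open MeasureTheory Filter Topology
open Literature.MathematicalPhysics.QuantumFieldTheory Literature.MathematicalPhysics.QuantumLattice
open Summit.QuantumFields.YangMills.Cruxes.OSLegsFromFemtoAndGap.DlrCollarTransfer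
open Summit.QuantumFields.YangMills.Theorems.ThermalDescentTorusDictionary (aF eF zOf ccZ)
open Summit.QuantumFields.YangMills.Theorems.ThermalDescentReflection (negT reflFT)
open Summit.QuantumFields.YangMills.Theorems.SqueezedSkewnessAntipodalReflectedDictionary (covF_reflFT_eq_torusCov_reflect)

/-! ## §1–§2 The single site, the cube, and the core estimate -/

section Core

variable {G : Type} [Group G] [TopologicalSpace G] [IsTopologicalGroup G] [CompactSpace G]
  [MeasurableSpace G] [BorelSpace G] (r : LatticeRep G) (a : ℝ → ℝ)

/-- The indicator weight of the route's `ind h` picks out the single site `(0⃗, h)` of the `Fin`-torus. [folklore] -/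
theorem sum_ind_mul (L : ℕ) (f : FinTorusSite (2 * L + 1) (2 * L + 1) (2 * L + 1) (2 * L + 1) → ℝ) :
    ∑ x : FinTorusSite (2 * L + 1) (2 * L + 1) (2 * L + 1) (2 * L + 1),
        (if x.2.2.2.val = (2 * L + 1) / 4 ∧ x.1.val = 0 ∧ x.2.1.val = 0 ∧ x.2.2.1.val = 0 then (1 : ℝ) else 0) * f x =
      f ((0 : Fin (2 * L + 1)), (0 : Fin (2 * L + 1)), (0 : Fin (2 * L + 1)),
        (⟨(2 * L + 1) / 4, by omega⟩ : Fin (2 * L + 1))) := by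
  rw [Finset.sum_eq_single ((0 : Fin (2 * L + 1)), (0 : Fin (2 * L + 1)), (0 : Fin (2 * L + 1)),
    (⟨(2 * L + 1) / 4, by omega⟩ : Fin (2 * L + 1)))]
  · simp
  · intro x _ hx
    rw [ite_eq_right_iff.2, zero_mul]
    intro hc
    exfalso
    apply hx
    obtain ⟨x1, x2, x3, t⟩ := x
    simp only [Prod.mk.injEq]
    refine ⟨Fin.ext ?_, Fin.ext ?_, Fin.ext ?_, Fin.ext ?_⟩
    · simpa using hc.2.1
    · simpa using hc.2.2.1
    · simpa using hc.2.2.2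
    · simpa using hc.1
  · intro h; exact absurd (Finset.mem_univ _) h

/-- `zOf` of the site `(0⃗, h)`, `h = ⌊(2L+1)/4⌋`, is the time-first `ℤ⁴` site `(h, 0, 0, 0)`. [folklore] -/
theorem zOf_axis (L : ℕ) :
    zOf (2 * L + 1) ((0 : Fin (2 * L + 1)), (0 : Fin (2 * L + 1)), (0 : Fin (2 * L + 1)),
        (⟨(2 * L + 1) / 4, by omega⟩ : Fin (2 * L + 1))) = ![(((2 * L + 1) / 4 : ℕ) : ℤ), 0, 0, 0] := by
  have h0 : ccZ (2 * L + 1) (0 : Fin (2 * L + 1)) = 0 := by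
    simp [ccZ]
  have hh : ccZ (2 * L + 1) (⟨(2 * L + 1) / 4, by omega⟩ : Fin (2 * L + 1)) = (((2 * L + 1) / 4 : ℕ) : ℤ) := by
    unfold ccZ
    rw [if_pos (by simp only; omega)]
  unfold zOf
  simp only [h0, hh]

/-- **THE CORE ESTIMATE of the Markov-ceiling glue** (narrow form).  From the femto boundary law `FBL` (constants
`C₁, β₁, ℓ₁, p`) and boundary-response mixing, for every `η > 0` there are `β₆, Λ₆` such that for `β ≥ β₆`, `a(β)·L ≥ Λ₆` the
`Fin`-torus reflection covariance of the plaquette sum at `(0⃗, ⌊(2L+1)/4⌋)` (the route's `N β (2L+1) (2L+1) ⌊(2L+1)/4⌋`, written with the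
indicator weights of `Bc (ind h)`) is `≤ η·a(β)⁸`: reflected dictionary → Markov mirror X2 on the cube of side `2R+1`,
`R = ⌊ℓ₁/(4a)⌋`, centred at `z₀ = (h, 0⃗)` → `FBL` sup bound `6C₁`-type `s = C₁/(R+1)⁴` → mixing with `τ = η ℓ₁⁸/(8⁸(C₁²+1))`. [folklore] -/
theorem cov_ind_reflFT_le (ha₀ : ∀ β, 0 < a β) (ha : Tendsto a atTop (𝓝 0)) (hFBL : FBL G r a)
    (hN : ∀ (ℓ τ : ℝ), 0 < ℓ → 0 < τ → ∃ (β₆ Λ₆ : ℝ), ∀ β : ℝ, β₆ ≤ β → ∀ L : ℕ, Λ₆ ≤ a β * L →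
      ∀ (c : Fin 4 → ℤ) (b : ℕ), (b : ℝ) * a β ≤ ℓ → 1 ≤ c 0 → c 0 + (b : ℤ) + 3 ≤ (L : ℤ) →
      (∀ j : Fin 4, -(L : ℤ) + 2 ≤ c j ∧ c j + (b : ℤ) + 2 ≤ (L : ℤ) + 1) → c 0 ≤ (((2 * L + 1) / 4 : ℕ) : ℤ) →
      (((2 * L + 1) / 4 : ℕ) : ℤ) ≤ c 0 + (b : ℤ) → ∀ (z : Fin 4 → ℤ), 1 ≤ depth c b z → ∀ (m s : ℝ),
      (∀ V : LGConfig 4 G, |kerE G r β c b V (dens G r z) - m| ≤ s) →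
      torusE G r β L (fun V => kerE G r β c b (cfgReflect V) (dens G r z) * kerE G r β c b V (dens G r z)) -
        torusE G r β L (fun V => kerE G r β c b (cfgReflect V) (dens G r z)) *
          torusE G r β L (fun V => kerE G r β c b V (dens G r z)) ≤ τ * s ^ 2)
    (η : ℝ) (hη : 0 < η) :
    ∃ (β₆ Λ₆ : ℝ), ∀ β : ℝ, β₆ ≤ β → ∀ L : ℕ, Λ₆ ≤ a β * L →
      eF r β (2 * L + 1) (fun V =>
          (∑ x : FinTorusSite (2 * L + 1) (2 * L + 1) (2 * L + 1) (2 * L + 1),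
            (if x.2.2.2.val = (2 * L + 1) / 4 ∧ x.1.val = 0 ∧ x.2.1.val = 0 ∧ x.2.2.1.val = 0 then (1 : ℝ) else 0) *
              aF r x (reflFT V)) *
          ∑ x : FinTorusSite (2 * L + 1) (2 * L + 1) (2 * L + 1) (2 * L + 1),
            (if x.2.2.2.val = (2 * L + 1) / 4 ∧ x.1.val = 0 ∧ x.2.1.val = 0 ∧ x.2.2.1.val = 0 then (1 : ℝ) else 0) *
              aF r x V) -
        eF r β (2 * L + 1) (fun V =>
          ∑ x : FinTorusSite (2 * L + 1) (2 * L + 1) (2 * L + 1) (2 * L + 1),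
            (if x.2.2.2.val = (2 * L + 1) / 4 ∧ x.1.val = 0 ∧ x.2.1.val = 0 ∧ x.2.2.1.val = 0 then (1 : ℝ) else 0) *
              aF r x (reflFT V)) *
        eF r β (2 * L + 1) (fun V =>
          ∑ x : FinTorusSite (2 * L + 1) (2 * L + 1) (2 * L + 1) (2 * L + 1),
            (if x.2.2.2.val = (2 * L + 1) / 4 ∧ x.1.val = 0 ∧ x.2.1.val = 0 ∧ x.2.2.1.val = 0 then (1 : ℝ) else 0) *
              aF r x V) ≤ η * a β ^ 8 := by
  obtain ⟨C₁, β₁, ℓ₁, p, hℓ₁, hC₁, hF⟩ := hFBL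
  -- the mixing tolerance
  set τ : ℝ := η * ℓ₁ ^ 8 / (8 ^ 8 * (C₁ ^ 2 + 1)) with hτ
  have hτ0 : 0 < τ := by positivity
  obtain ⟨β₆', Λ₆', hN'⟩ := hN ℓ₁ τ hℓ₁ hτ0
  -- `a β` small eventually
  have hε : 0 < min (ℓ₁ / 8) 1 := by positivity
  obtain ⟨βa, hβa⟩ := Filter.eventually_atTop.1 (ha.eventually (Iio_mem_nhds hε))
  refine ⟨max (max β₆' β₁) βa, max Λ₆' (2 * ℓ₁ + 24), fun β hβ L hL => ?_⟩
  have hβ6 : β₆' ≤ β := le_trans (le_trans (le_max_left _ _) (le_max_left _ _)) hβ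
  have hβ1 : β₁ ≤ β := le_trans (le_trans (le_max_right _ _) (le_max_left _ _)) hβ
  have hβa' : βa ≤ β := le_trans (le_max_right _ _) hβ
  have hA : 0 < a β := ha₀ β
  have hAlt : a β < min (ℓ₁ / 8) 1 := hβa β hβa'
  have hA8 : a β ≤ ℓ₁ / 8 := (hAlt.le).trans (min_le_left _ _)
  have hA1 : a β ≤ 1 := (hAlt.le).trans (min_le_right _ _)
  have hL' : Λ₆' ≤ a β * L := le_trans (le_max_left _ _) hL
  have hL2 : 2 * ℓ₁ + 24 ≤ a β * L := le_trans (le_max_right _ _) hL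
  -- the radius `R`
  set R : ℕ := ⌊ℓ₁ / (4 * a β)⌋₊ with hRdef
  have hR_le : (R : ℝ) ≤ ℓ₁ / (4 * a β) := Nat.floor_le (by positivity)
  have hR_gt : ℓ₁ / (4 * a β) < (R : ℝ) + 1 := Nat.lt_floor_add_one _
  have hR2 : 2 ≤ R := by
    refine Nat.le_floor ?_
    rw [Nat.cast_ofNat, le_div_iff₀ (by positivity)]
    linarith
  -- the one natural-number fact: `8R + 24 ≤ L`
  have h8 : 8 * R + 24 ≤ L := by
    have h1 : (8 * R : ℝ) ≤ 2 * ℓ₁ / a β := by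
      have : (8 : ℝ) * (ℓ₁ / (4 * a β)) = 2 * ℓ₁ / a β := by
        field_simp; ring
      calc (8 * R : ℝ) ≤ 8 * (ℓ₁ / (4 * a β)) := by gcongr
        _ = 2 * ℓ₁ / a β := this
    have h2 : (24 : ℝ) ≤ 24 / a β := by
      rw [le_div_iff₀ hA]; nlinarith
    have h3 : (2 * ℓ₁ + 24) / a β ≤ L := by
      rw [div_le_iff₀ hA]; linarith
    have h4 : (8 * R + 24 : ℝ) ≤ L := by
      calc (8 * R + 24 : ℝ) ≤ 2 * ℓ₁ / a β + 24 / a β := by linarith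
        _ = (2 * ℓ₁ + 24) / a β := by rw [add_div]
        _ ≤ L := h3
    exact_mod_cast h4
  -- the height `h`, the cube
  have hh1 : R + 1 ≤ (2 * L + 1) / 4 := by omega
  have hh2 : (2 * L + 1) / 4 + R + 4 ≤ L := by omega
  set z₀ : Fin 4 → ℤ := ![(((2 * L + 1) / 4 : ℕ) : ℤ), 0, 0, 0] with hz₀
  set c : Fin 4 → ℤ := fun j => z₀ j - R with hc
  set b : ℕ := 2 * R + 1 with hb
  have hbℓ : (b : ℝ) * a β ≤ ℓ₁ := by
    have : (b : ℝ) = 2 * R + 1 := by simp [hb]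
    rw [this]
    have hRa : (R : ℝ) * a β ≤ ℓ₁ / 4 := by
      calc (R : ℝ) * a β ≤ ℓ₁ / (4 * a β) * a β := by gcongr
        _ = ℓ₁ / 4 := by field_simp
    nlinarith
  -- depth of the centre
  have hd : (R : ℝ) + 1 ≤ (depth c b z₀ : ℝ) := by
    have := StubLower.le_depth_cube z₀ z₀ R (t := 0) (fun j => by simp)
    simpa using this
  have hd2 : 2 ≤ depth c b z₀ := by
    have : ((2 : ℕ) : ℝ) ≤ (depth c b z₀ : ℝ) := by
      have : (2 : ℝ) ≤ (R : ℝ) + 1 := by exact_mod_cast Nat.succ_le_succ (le_trans (by norm_num) hR2)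
      push_cast; linarith
    exact_mod_cast this
  have hd1 : 1 ≤ depth c b z₀ := le_trans (by norm_num) hd2
  -- window arithmetic
  have hc0 : c 0 = (((2 * L + 1) / 4 : ℕ) : ℤ) - R := by simp [hc, hz₀]
  have hcj : ∀ j : Fin 4, j ≠ 0 → c j = -(R : ℤ) := by
    intro j hj
    fin_cases j
    · exact absurd rfl hj
    all_goals simp [hc, hz₀]
  have W1 : 1 ≤ c 0 := by rw [hc0]; omega
  have W2 : c 0 + (b : ℤ) + 3 ≤ (L : ℤ) := by rw [hc0]; simp only [hb]; push_cast; omega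
  have W3 : ∀ j : Fin 4, -(L : ℤ) + 2 ≤ c j ∧ c j + (b : ℤ) + 2 ≤ (L : ℤ) + 1 := by
    intro j
    by_cases hj : j = 0
    · subst hj; rw [hc0]; simp only [hb]; push_cast; constructor <;> omega
    · rw [hcj j hj]; simp only [hb]; push_cast; constructor <;> omega
  have W4 : c 0 ≤ (((2 * L + 1) / 4 : ℕ) : ℤ) := by rw [hc0]; omega
  have W5 : (((2 * L + 1) / 4 : ℕ) : ℤ) ≤ c 0 + (b : ℤ) := by
    rw [hc0]; simp only [hb]; push_cast; omega
  -- FBL sup bound at the centre, uniform in the exterior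
  have hRpos : (0 : ℝ) < (R : ℝ) + 1 := by positivity
  have hs : ∀ V : LGConfig 4 G, |kerE G r β c b V (dens G r z₀) - p β| ≤ C₁ / ((R : ℝ) + 1) ^ 4 := fun V =>
    (hF β hβ1 c b hbℓ V z₀ hd2).trans
      (div_le_div_of_nonneg_left hC₁ (by positivity) (pow_le_pow_left₀ hRpos.le hd 4))
  -- boundary-response mixing
  have hmix := hN' β hβ6 L hL' c b hbℓ W1 W2 W3 W4 W5 z₀ hd1 (p β) (C₁ / ((R : ℝ) + 1) ^ 4) hs
  -- the Markov mirror identity X2 for `F₁ = F₂ = dens z₀`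
  have hwin : ∀ e ∈ r.curvature.supp.image (fun e => (e.1 - -z₀, e.2)), ∀ j : Fin 4,
      c j ≤ e.1 j ∧ e.1 j ≤ c j + b := by
    intro e he j
    obtain ⟨h0, h1⟩ := near_of_mem_supp_dens r he j
    simp only [hc, hb]
    push_cast
    constructor <;> omega
  have hX2 := Summit.QuantumFields.YangMills.Cruxes.NT.MarkovMirror.torusCov_reflect_lift_eq_torusCov_reflect_kerE G r β c b L
    W1 W2 W3 (continuous_dens r z₀) (continuous_dens r z₀) (fun U => abs_curvature_le r _) (fun U => abs_curvature_le r _)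
    (isCylinder_dens r z₀) (isCylinder_dens r z₀) hwin hwin
  -- collapse the indicator sums, apply the reflected dictionary, X2, mixing
  set xh : FinTorusSite (2 * L + 1) (2 * L + 1) (2 * L + 1) (2 * L + 1) :=
    ((0 : Fin (2 * L + 1)), (0 : Fin (2 * L + 1)), (0 : Fin (2 * L + 1)), (⟨(2 * L + 1) / 4, by omega⟩ : Fin (2 * L + 1)))
    with hxh
  have e1 : ∀ V, (∑ x : FinTorusSite (2 * L + 1) (2 * L + 1) (2 * L + 1) (2 * L + 1),
      (if x.2.2.2.val = (2 * L + 1) / 4 ∧ x.1.val = 0 ∧ x.2.1.val = 0 ∧ x.2.2.1.val = 0 then (1 : ℝ) else 0) * aF r x V) =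
        aF r xh V := fun V => sum_ind_mul L _
  simp only [e1]
  have hz : zOf (2 * L + 1) xh = z₀ := zOf_axis L
  rw [covF_reflFT_eq_torusCov_reflect, hz, hX2]
  refine hmix.trans ?_
  -- τ · s² ≤ η · a⁸
  have hq : ℓ₁ / (8 * a β) ≤ (R : ℝ) + 1 := by
    have : ℓ₁ / (8 * a β) ≤ ℓ₁ / (4 * a β) := by
      apply div_le_div_of_nonneg_left hℓ₁.le (by positivity); nlinarith
    linarith
  have hq0 : 0 < ℓ₁ / (8 * a β) := by positivity
  have hs' : C₁ / ((R : ℝ) + 1) ^ 4 ≤ C₁ * (8 * a β / ℓ₁) ^ 4 := by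
    have e : C₁ * (8 * a β / ℓ₁) ^ 4 = C₁ / (ℓ₁ / (8 * a β)) ^ 4 := by
      field_simp
    rw [e]
    exact div_le_div_of_nonneg_left hC₁ (by positivity) (pow_le_pow_left₀ hq0.le hq 4)
  have hs0 : 0 ≤ C₁ / ((R : ℝ) + 1) ^ 4 := by positivity
  calc τ * (C₁ / ((R : ℝ) + 1) ^ 4) ^ 2 ≤ τ * (C₁ * (8 * a β / ℓ₁) ^ 4) ^ 2 := by gcongr
    _ = η * a β ^ 8 * (C₁ ^ 2 / (C₁ ^ 2 + 1)) := by
        simp only [hτ]; field_simp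
    _ ≤ η * a β ^ 8 * 1 := by
        gcongr
        exact (div_le_one (by positivity)).2 (by linarith)
    _ = η * a β ^ 8 := mul_one _

end Core

end Summit.QuantumFields.YangMills.Theorems.SqueezedSkewnessAntipodalMarkovGlueNarrow


/-! ## §3 The registered stub `stub_markovGlueNarrow` of the «Markov ceiling» skeleton, BY NAME AND SIGNATURE -/

namespace Summit.QuantumFields.YangMills.Theorems.SqueezedSkewnessAntipodalMarkovGlueNarrow

open Filter Topology
open Literature.MathematicalPhysics.QuantumFieldTheory Literature.MathematicalPhysics.QuantumLattice
open Summit.QuantumFields.YangMills.Theses.SqueezedSkewness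
open Summit.QuantumFields.YangMills.Cruxes.OSLegsFromFemtoAndGap.DlrCollarTransfer

/-! ### Name-keyed statements (verbatim from `Cruxes/NT/Lines/antipodal_markov_birth.lean`, v2 @9a38efe2) -/
namespace __Registered

/-- = `SqueezedSkewness.FloorUnitFBL6` (crux, XL; shared with the ElectricSeamH split). -/
abbrev stub_floorUnitFBL6 : Prop :=
  Summit.QuantumFields.YangMills.Theses.SqueezedSkewness.FloorUnitFBL6

/-- = `SqueezedSkewness.AntipodalMixing` (crux, L+/XL). -/
abbrev stub_antipodalMixing : Prop :=
  Summit.QuantumFields.YangMills.Theses.SqueezedSkewness.AntipodalMixing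

/-- **Narrow twin** `BoundaryResponseMixing` (v2, idea-crit-9 #53 P2), verbatim. -/
abbrev stub_boundaryResponseMixing : Prop :=
  ∀ (G : Type) [Group G] [TopologicalSpace G] [IsTopologicalGroup G] [CompactSpace G], IsCompactSimpleLieGroup G → letI : MeasurableSpace G := borel G; haveI : BorelSpace G := ⟨rfl⟩; ∀ (r : LatticeRep G) (a : ℝ → ℝ), (∀ β, 0 < a β) → Filter.Tendsto a Filter.atTop (nhds 0) → ∀ (ℓ τ : ℝ), 0 < ℓ → 0 < τ → ∃ (β₆ Λ₆ : ℝ), ∀ β : ℝ, β₆ ≤ β → ∀ L : ℕ, Λ₆ ≤ a β * L → ∀ (c : Fin 4 → ℤ) (b : ℕ), (b : ℝ) * a β ≤ ℓ → 1 ≤ c 0 → c 0 + (b : ℤ) + 3 ≤ (L : ℤ) → (∀ j : Fin 4, -(L : ℤ) + 2 ≤ c j ∧ c j + (b : ℤ) + 2 ≤ (L : ℤ) + 1) → c 0 ≤ (((2 * L + 1) / 4 : ℕ) : ℤ) → (((2 * L + 1) / 4 : ℕ) : ℤ) ≤ c 0 + (b : ℤ) → ∀ (z : Fin 4 → ℤ),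 1 ≤ depth c b z → ∀ (m s : ℝ), (∀ V : LGConfig 4 G, |kerE G r β c b V (dens G r z) - m| ≤ s) → torusE G r β L (fun V => kerE G r β c b (cfgReflect V) (dens G r z) * kerE G r β c b V (dens G r z)) - torusE G r β L (fun V => kerE G r β c b (cfgReflect V) (dens G r z)) * torusE G r β L (fun V => kerE G r β c b V (dens G r z)) ≤ τ * s ^ 2

/-- Glue for the narrow twin: `FloorUnitFBL6 → BoundaryResponseMixing → AntipodalMirrorCeiling`, verbatim. -/
abbrev stub_markovGlueNarrow : Prop :=
  Summit.QuantumFields.YangMills.Theses.SqueezedSkewness.FloorUnitFBL6 → stub_boundaryResponseMixing →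
    Summit.QuantumFields.YangMills.Theses.SqueezedSkewness.AntipodalMirrorCeiling

/-- Comparison stub `AntipodalMixing → BoundaryResponseMixing`, verbatim (NOT proved here). -/
abbrev stub_twinOfMixing : Prop :=
  Summit.QuantumFields.YangMills.Theses.SqueezedSkewness.AntipodalMixing → stub_boundaryResponseMixing

end __Registered

/-- **STUB `stub_markovGlueNarrow` HOLDS**: the femto boundary law at floor-calibrated units (fed the low-pass floor that is
`AntipodalMirrorCeiling`'s own antecedent, `Or.inl`) and boundary-response mixing give the antipodal mirror ceiling
`N β (2L+1) (2L+1) ⌊(2L+1)/4⌋ ≤ η·a(β)⁸` — `fbl_of_fbl6` + the core estimate `cov_ind_reflFT_le` (reflected dictionary, X2, FBL sup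
bound, mixing), read against the route's `let`-bound statement by `dsimp only` + definitional unfolding. [folklore] -/
theorem stub_markovGlueNarrow : __Registered.stub_markovGlueNarrow := by
  intro h1 hN G _ _ _ _ hG r a ha₀ ha
  dsimp only
  intro hfloor η hη
  letI : MeasurableSpace G := borel G
  haveI : BorelSpace G := ⟨rfl⟩
  have hF6 : FBL6 G r a := by
    have h1' := h1 G hG r a ha₀ ha
    dsimp only at h1'
    exact h1' (Or.inl hfloor)
  exact cov_ind_reflFT_le r a ha₀ ha (fbl_of_fbl6 r a hF6) (hN G hG r a ha₀ ha) η hη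

/-- **`AntipodalMirrorCeiling` from the UV item and the NARROW twin** (the skeleton's `AntipodalMirrorCeiling_of_narrow`, now with the
glue discharged): `FloorUnitFBL6 → BoundaryResponseMixing → AntipodalMirrorCeiling`. -/
theorem antipodalMirrorCeiling_of_narrow (h1 : __Registered.stub_floorUnitFBL6)
    (hN : __Registered.stub_boundaryResponseMixing) : AntipodalMirrorCeiling :=
  stub_markovGlueNarrow h1 hN

/-- The filed decomposition factors through the twin: `FloorUnitFBL6 → AntipodalMixing → (twinOfMixing) → AntipodalMirrorCeiling`. -/
theorem antipodalMirrorCeiling_of_via_twin (h1 : __Registered.stub_floorUnitFBL6)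
    (h2 : __Registered.stub_antipodalMixing) (hT : __Registered.stub_twinOfMixing) : AntipodalMirrorCeiling :=
  stub_markovGlueNarrow h1 (hT h2)

end Summit.QuantumFields.YangMills.Theorems.SqueezedSkewnessAntipodalMarkovGlueNarrow
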